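import Mathlib.Analysis.Normed.Operator.Compact.Basic
import Mathlib.Analysis.Normed.Module.RieszLemma
import Mathlib.LinearAlgebra.Eigenspace.Basic
import Mathlib.Topology.Algebra.Module.FiniteDimension
import HarnessLib

/-!
# Stub `stub_eigenFinite` of the line `malkin-cone-group-orbits` (crux stmt-AnomalousDissipation-1144):
# Riesz–Schauder finiteness of the eigenvalues of a compact operator away from `0`

Registered signature (proved here, textually):
`theorem stub_eigenFinite : ∀ {X : Type*} [NormedAddCommGroup X] [NormedSpace ℝ X] (T : X →L[ℝ] X),
  IsCompactOperator T → ∀ r : ℝ, 0 < r →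
    {μ : ℝ | r ≤ |μ| ∧ Module.End.HasEigenvalue (T : Module.End ℝ X) μ}.Finite`.

A compact operator `T` on a real normed space has only finitely many eigenvalues `μ` with `|μ| ≥ r > 0`
(Rudin, *Functional Analysis*, Thm. 4.24; Riesz–Sz.-Nagy §§77–78; Kato 1966, III-§6.7 Thm. 6.26).
F. Riesz's argument: an injective sequence of such eigenvalues `μₙ` with eigenvectors `vₙ` (linearly
independent, `Module.End.eigenvectors_linearIndependent'`) gives the strictly increasing chain of
finite-dimensional, hence closed, `T`-invariant spans `Fₙ = span {v₀, …, vₙ₋₁}` with `(T − μₙ) Fₙ₊₁ ⊆ Fₙ`;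
Riesz's lemma (`riesz_lemma_of_norm_lt`) in `Fₙ₊₁` relative to `Fₙ` gives `yₙ ∈ Fₙ₊₁`, `‖yₙ‖ ≤ 3`, at
distance `≥ 1` from `Fₙ`; the bounded vectors `wₙ = μₙ⁻¹ yₙ` (`‖wₙ‖ ≤ 3/r`) have `1`-separated images
`T wₙ ∈ yₙ + Fₙ`, contradicting the relative compactness of `T (closedBall 0 (3/r))`
(`IsCompactOperator.image_closedBall_subset_compact`, `IsCompact.tendsto_subseq`).
Mathlib (this pin) has the Fredholm alternative for compact operators
(`IsCompactOperator.hasEigenvalue_iff_mem_spectrum`) but not this finiteness statement.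
Pure proof file (no definitions); the proof is adapted from the tree's complex quasi-compact version
`Literature.Analysis.OperatorTheory.finite_setOf_hasEigenvalue_norm_le` (case `s = 0`, over `ℝ`).
-/

-- `Summit.<Summit>.<Problem>` is the tree's mandated summit-side namespace (CONVENTIONS §2); for this
-- single-conjunct summit the two coincide, so the duplicate is deliberate.
set_option linter.dupNamespace false

noncomputable section

open scoped BigOperators Topology
open Filter Set Function Metric

namespace Summit.AnomalousDissipation.AnomalousDissipation.Theorems.RobustLoudUpgrade.Poly.EigenFinite

/-- **The registered stub `stub_eigenFinite`** (Riesz–Schauder, general): a compact operator `T` on a real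
normed space has only finitely many eigenvalues `μ` of modulus `|μ| ≥ r > 0` (F. Riesz's argument: Riesz's
lemma along the flag spanned by eigenvectors of distinct eigenvalues, then the compactness of `T` on a
bounded `1`-separated image sequence; Rudin, *Functional Analysis* Thm. 4.24; Riesz–Sz.-Nagy §§77–78;
Kato 1966, III-§6.7 Thm. 6.26). [folklore] -/
theorem stub_eigenFinite :
    ∀ {X : Type*} [NormedAddCommGroup X] [NormedSpace ℝ X] (T : X →L[ℝ] X), IsCompactOperator T →
      ∀ r : ℝ, 0 < r → {μ : ℝ | r ≤ |μ| ∧ Module.End.HasEigenvalue (T : Module.End ℝ X) μ}.Finite := by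
  -- adapted from `Literature.Analysis.OperatorTheory.finite_setOf_hasEigenvalue_norm_le`
  -- (Literature/Analysis/OperatorTheory/QuasiCompactSpectralGap.lean), case `s = 0`, field `ℝ`.
  intro X _ _ T hT r hr
  by_contra hinf
  rw [← Set.not_infinite, not_not] at hinf
  -- an injective sequence of eigenvalues `μ n`, `r ≤ |μ n|`, with eigenvectors `v n`
  set emb := hinf.natEmbedding
  let μ : ℕ → ℝ := fun n => (emb n : ℝ)
  have hμinj : Function.Injective μ := fun a b hab => emb.injective (Subtype.ext hab)
  have hμ : ∀ n, r ≤ |μ n| ∧ Module.End.HasEigenvalue (T : Module.End ℝ X) (μ n) :=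
    fun n => (emb n).2
  have hμ0 : ∀ n, μ n ≠ 0 := fun n h => by
    have := (hμ n).1; rw [h, abs_zero] at this; exact absurd this (not_le.2 hr)
  choose v hv using fun n => (hμ n).2.exists_hasEigenvector
  have hTv : ∀ n, T (v n) = μ n • v n := fun n => (hv n).apply_eq_smul
  have hli : LinearIndependent ℝ v :=
    Module.End.eigenvectors_linearIndependent' (T : Module.End ℝ X) μ hμinj v hv
  -- the chain of spans `F n = span {v 0, …, v (n-1)}`: increasing, closed, `T`-invariant
  let F : ℕ → Submodule ℝ X := fun n => Submodule.span ℝ (v '' Iio n)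
  have hFmono : ∀ {a b : ℕ}, a ≤ b → F a ≤ F b := fun hab =>
    Submodule.span_mono (image_mono (Iio_subset_Iio hab))
  have hvF : ∀ n, v n ∈ F (n + 1) := fun n =>
    Submodule.subset_span ⟨n, Nat.lt_succ_self n, rfl⟩
  have hvnF : ∀ n, v n ∉ F n := fun n => hli.notMem_span_image (by simp)
  have hFclosed : ∀ n, IsClosed (F n : Set X) := fun n => by
    haveI : FiniteDimensional ℝ (F n) :=
      FiniteDimensional.span_of_finite ℝ ((finite_Iio n).image v)
    exact Submodule.closed_of_finiteDimensional _
  have hTF : ∀ n, ∀ x ∈ F n, T x ∈ F n := by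
    intro n x hx
    have h : (F n).map (T : X →ₗ[ℝ] X) ≤ F n := by
      refine Submodule.map_span_le _ _ _ |>.2 ?_
      rintro _ ⟨i, hi, rfl⟩
      change T (v i) ∈ F n
      rw [hTv]; exact Submodule.smul_mem _ _ (Submodule.subset_span ⟨i, hi, rfl⟩)
    exact h ⟨x, hx, rfl⟩
  -- `T y − μ n • y ∈ F n` for `y ∈ F (n+1)`
  have hstep : ∀ n, ∀ y ∈ F (n + 1), T y - μ n • y ∈ F n := by
    intro n y hy
    have hy' : y ∈ Submodule.span ℝ (insert (v n) (v '' Iio n)) := by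
      have : v '' Iio (n + 1) = insert (v n) (v '' Iio n) := by
        rw [← image_insert_eq]; congr 1; ext i; simp
      change y ∈ Submodule.span ℝ (v '' Iio (n + 1)) at hy
      rwa [this] at hy
    obtain ⟨c, f, hf, rfl⟩ := Submodule.mem_span_insert.1 hy'
    have : T (c • v n + f) - μ n • (c • v n + f) = T f - μ n • f := by
      rw [map_add, map_smul, hTv, smul_add, smul_comm c (μ n) (v n)]; abel
    rw [this]
    exact Submodule.sub_mem _ (hTF n f hf) (Submodule.smul_mem _ _ hf)
  -- Riesz's lemma in `F (n+1)` relative to its closed proper subspace `F n`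
  have hRiesz : ∀ n, ∃ y ∈ F (n + 1), ‖y‖ ≤ 3 ∧ ∀ f ∈ F n, 1 ≤ ‖y - f‖ := by
    intro n
    let G : Submodule ℝ (F (n + 1)) := (F n).comap (F (n + 1)).subtype
    have hGc : IsClosed (G : Set (F (n + 1))) := (hFclosed n).preimage continuous_subtype_val
    have hG : ∃ x : F (n + 1), x ∉ G := ⟨⟨v n, hvF n⟩, hvnF n⟩
    obtain ⟨x₀, hx₀, hx₀'⟩ := riesz_lemma_of_norm_lt (c := (2 : ℝ)) (by norm_num)
      (R := 3) (by norm_num) hGc hG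
    refine ⟨x₀, x₀.2, by simpa using hx₀, fun f hf => ?_⟩
    have := hx₀' ⟨f, hFmono (Nat.le_succ n) hf⟩ hf
    simpa using this
  choose y hyF hy3 hysep using hRiesz
  -- the bounded vectors `w n = (μ n)⁻¹ • y n`, `‖w n‖ ≤ 3 / r`
  let w : ℕ → X := fun n => (μ n)⁻¹ • y n
  have hwnorm : ∀ n, ‖w n‖ ≤ 3 * r⁻¹ := fun n => by
    change ‖(μ n)⁻¹ • y n‖ ≤ _
    rw [norm_smul, norm_inv, Real.norm_eq_abs, mul_comm]
    gcongr
    · exact hy3 n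
    · exact (hμ n).1
  -- `T (w n) ∈ y n + F n`, hence the images `T (w n)` are `1`-separated
  have hTw : ∀ n, T (w n) - y n ∈ F n := fun n => by
    have h := Submodule.smul_mem (F n) (μ n)⁻¹ (hstep n (y n) (hyF n))
    rwa [smul_sub, smul_smul, inv_mul_cancel₀ (hμ0 n), one_smul, ← map_smul] at h
  have hsep : ∀ l n, l < n → 1 ≤ ‖T (w n) - T (w l)‖ := by
    intro l n hln
    have hwl : T (w l) ∈ F n :=
      hFmono (Nat.succ_le_of_lt hln) (hTF (l + 1) _ (Submodule.smul_mem _ _ (hyF l)))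
    set f : X := (T (w n) - y n) - T (w l) with hf
    have hfF : f ∈ F n := Submodule.sub_mem _ (hTw n) hwl
    have heq : T (w n) - T (w l) = y n - (-f) := by
      simp only [hf]; abel
    rw [heq]
    exact hysep n (-f) (Submodule.neg_mem _ hfF)
  -- compactness of `T` on the bounded sequence `w n` gives a Cauchy subsequence: contradiction
  obtain ⟨K, hK, hKw⟩ := hT.image_closedBall_subset_compact (f := (T : X →ₗ[ℝ] X)) (3 * r⁻¹)
  obtain ⟨x, -, ψ, hψ, hψx⟩ := hK.tendsto_subseq
    (x := fun n => T (w n)) fun n => hKw ⟨w n, mem_closedBall_zero_iff.2 (hwnorm n), rfl⟩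
  have hc := hψx.cauchySeq
  rw [Metric.cauchySeq_iff'] at hc
  obtain ⟨N₀, hN₀⟩ := hc 1 one_pos
  have hlt := hN₀ (N₀ + 1) (Nat.le_succ _)
  rw [dist_eq_norm] at hlt
  exact (not_le.2 hlt) (hsep _ _ (hψ (Nat.lt_succ_self N₀)))

end Summit.AnomalousDissipation.AnomalousDissipation.Theorems.RobustLoudUpgrade.Poly.EigenFinite

end
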